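import Literature.AnabelianGeometry.AbsoluteAnabelian.RigidFunctors
import Literature.AnabelianGeometry.Anabelioids.SlimProofs
import HarnessLib

/-!
# Slim categories are id-rigid, and so are all their slices; `B(Π)` for slim `Π`

S. Mochizuki, *Topics in absolute anabelian geometry III*, §0 "Categories" p. 27 (kurims manuscript,
lit key `paper:url-5493eb38cbb7`): "a functor `φ : 𝒞 → 𝒞'` is rigid if every automorphism of `φ` is
equal to the identity; if the identity functor of `𝒞` is rigid, then we shall say that `𝒞` is
id-rigid"; S. Mochizuki, *The geometry of Frobenioids I*, §0 p. 14: "`𝒞` is slim if the natural functor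
`𝒞_A → 𝒞` is rigid for every `A ∈ Ob(𝒞)`"; [SemiAnbd] §0 p. 6 / [GeoAn] Cor. 1.1.6: "`B(G)` is slim if
and only if `Z_G(H) = {1}` for every open subgroup `H ⊆ G`".

PROOF-ONLY file (abc-iut cell, wave 5, seat abc-iut-w5-d215; sub-DAG `plan/L4/SUBDAG-AbsTopIII-Prop42.md`
row P42.i/L10, the follow-up lemma offered there: "the abstract principle `IsSlimGroup Π → IsIdRigid`
(finite étale `Π`-sets over varying base)").  It connects the two typed notions of the tree —
abc-iut-L1's `Literature.AlgebraicGeometry.Frobenioids.IsSlim` ([FrdI] §0: every `Over.forget A` is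
rigid) and abc-iut-L4's `Literature.AnabelianGeometry.AbsoluteAnabelian.IsIdRigid` ([AbsTopIII] §0: the
identity functor is rigid) — by the elementary principle every use of "slim ⇒ id-rigid" in
[AbsTopIII] Def. 3.5 (v)/(vi), Prop. 4.2 (i) ("the id-rigidity of `EA` follows immediately from the
slimness assertion of Lemma 4.3", p. 106 l. 18–19), Cor. 4.5 (v) rests on:

* `isIdRigid_of_isSlim` — a slim category is id-rigid: an automorphism `α` of `𝟭_𝒞` restricts, for
  each object `x`, to an automorphism of the forgetful functor `𝒞_x → 𝒞` (components `α_{B}` at the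
  sources `B` of the arrows `B → x`), which is trivial by slimness; its component at `𝟙_x` is `α_x`;
* `isIdRigid_over_of_isSlim` — every slice `𝒞_A` of a slim category is id-rigid ("over varying
  base"): whisker an automorphism of `𝟭_{𝒞_A}` with the faithful `𝒞_A → 𝒞`;
* `isIdRigid_bCat_of_isSlimGroup`, `isIdRigid_over_bCat_of_isSlimGroup` — for a profinite group `G`
  all of whose open subgroups have trivial centraliser (`IsSlimGroup G`), the category `B(G)` of finite
  continuous `G`-sets and every slice `B(G)_A` are id-rigid — through the landed theorem
  `Literature.AnabelianGeometry.Anabelioids.bCat_isSlim_iff_isSlimGroup_holds` ([SemiAnbd] §0 p. 6,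
  abc-iut-L3).

No definition, no named fact; nothing here bears on [IUTchIII] Cor. 3.12.
-/

namespace Literature.AnabelianGeometry.AbsoluteAnabelian

open _root_.CategoryTheory

universe v u

section Slim

variable {C : Type u} [Category.{v} C]

/-- **A slim category is id-rigid** ([FrdI] §0 p. 14 "slim" ⇒ [AbsTopIII] §0 p. 27 "id-rigid"): an
automorphism `α` of `𝟭_𝒞` has identity components.  For an object `x`, the family
`B ↦ α_{B.left}` (over the arrows `B → x`) is an automorphism of the forgetful functor `𝒞_x → 𝒞`
(naturality of `α`), hence the identity by slimness; evaluate at `𝟙_x : x → x`.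
[cite: MochizukiAbsTopIII2015, Section 0 p.27] -/
theorem isIdRigid_of_isSlim (h : Literature.AlgebraicGeometry.Frobenioids.IsSlim C) : IsIdRigid C := by
  refine isRigidFunctor_of_hom_app_eq_id fun α x => ?_
  -- the induced automorphism of `Over.forget x`
  let β : Over.forget x ≅ Over.forget x :=
    NatIso.ofComponents (fun B => α.app B.left) (fun {B B'} f => α.hom.naturality f.left)
  have hβ : β = Iso.refl _ := h.isRigid_forget x β
  have hx : β.hom.app (Over.mk (𝟙 x)) = 𝟙 x := by
    rw [hβ]
    rfl
  exact hx

/-- **Every slice of a slim category is id-rigid** ("finite étale objects over varying base"): an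
automorphism of `𝟭_{𝒞_A}`, whiskered with the faithful forgetful functor `𝒞_A → 𝒞`, is an automorphism
of that forgetful functor, hence trivial by slimness; faithfulness gives back the components.
[cite: MochizukiAbsTopIII2015, Section 0 p.27] -/
theorem isIdRigid_over_of_isSlim (h : Literature.AlgebraicGeometry.Frobenioids.IsSlim C) (A : C) :
    IsIdRigid (Over A) := by
  refine isRigidFunctor_of_hom_app_eq_id fun α B => (Over.forget A).map_injective ?_
  -- the whiskered automorphism of `Over.forget A`
  let β : Over.forget A ≅ Over.forget A :=
    NatIso.ofComponents (fun B => (Over.forget A).mapIso (α.app B))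
      (fun {B B'} f => by
        simp only [Functor.mapIso_hom, Iso.app_hom, ← Functor.map_comp]
        exact congrArg (Over.forget A).map (α.hom.naturality f))
  have hβ : β = Iso.refl _ := h.isRigid_forget A β
  have hB : β.hom.app B = 𝟙 ((Over.forget A).obj B) := by
    rw [hβ]
    rfl
  simpa [β] using hB

end Slim

section BCat

open Literature.AlgebraicGeometry.Frobenioids (BCat IsSlimGroup)
open Literature.AnabelianGeometry.Anabelioids (bCat_isSlim_iff_isSlimGroup_holds)

variable (G : Type) [Group G] [TopologicalSpace G] [IsTopologicalGroup G] [CompactSpace G]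
  [T2Space G] [TotallyDisconnectedSpace G]

/-- **`B(G)` is id-rigid for slim profinite `G`** ("the id-rigidity … follows immediately from the
slimness assertion", [AbsTopIII] Prop. 4.2 (i) proof p. 106 l. 18–19, in its abstract form): if every
open subgroup of the profinite group `G` has trivial centraliser, then the category `B(G)` of finite
continuous `G`-sets is id-rigid — [SemiAnbd] §0 p. 6 (`B(G)` slim iff `G` slim, landed as
`bCat_isSlim_iff_isSlimGroup_holds`) + `isIdRigid_of_isSlim`.
[cite: MochizukiAbsTopIII2015, Section 0 p.27] -/
theorem isIdRigid_bCat_of_isSlimGroup (hG : IsSlimGroup G) : IsIdRigid (BCat G) :=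
  isIdRigid_of_isSlim ((bCat_isSlim_iff_isSlimGroup_holds G).mpr hG)

/-- **Every slice `B(G)_A` is id-rigid for slim profinite `G`** (finite étale `G`-sets over a varying
base `A`; `B(G)_A ≃ B(G_a)` componentwise for the open stabilisers `G_a`, which are again slim).
[cite: MochizukiAbsTopIII2015, Section 0 p.27] -/
theorem isIdRigid_over_bCat_of_isSlimGroup (hG : IsSlimGroup G) (A : BCat G) : IsIdRigid (Over A) :=
  isIdRigid_over_of_isSlim ((bCat_isSlim_iff_isSlimGroup_holds G).mpr hG) A

end BCat

end Literature.AnabelianGeometry.AbsoluteAnabelian
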